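import Literature.Topology.Immersions.QuadruplePointsGenericity
import Literature.Topology.Immersions.NormalBundlePerturbation
import Literature.Topology.Immersions.VeroneseGenericity
import Mathlib.Geometry.Manifold.WhitneyEmbedding
import HarnessLib

/-!
# General position of maps into Euclidean space, V: a generic immersion next to any immersion

Topic `Literature/Topology/Immersions`. Assembly of parts I–IV with the stability of immersions:
**every `C^∞` immersion `f : M → ℝ^q` of a compact manifold with `4 dim M < 3q` has arbitrarily
small linear perturbations `g = f + Λ ∘ ρ` which are immersions in general position** — all
double points transverse, all triple points transverse, no quadruple points — and which are
joined to `f` by the regular homotopy `f + tΛ ∘ ρ`, `t ∈ [-1, 1]` (Hirsch, *Differential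
Topology* (1976), Ch. 3 §2, Thm. 2.7 and Exercises 1–2: immersions in general position are
dense; Golubitsky–Guillemin (1973), Ch. III §3 Prop. 3.2 / Cor. 3.3: immersions with normal
crossings are dense). This is the form in which generic immersions `M⁴ ↬ ℝ⁶` (`16 < 18`) are
produced for the double-point / triple-point calculus of Kirby, *The Topology of 4-Manifolds*
(1989), Ch. VI.

The auxiliary map is `ρ = (reindexing) ∘ veronese ∘ ρ₀` for a Whitney embedding `ρ₀` (Mathlib's
`exists_embedding_euclidean_of_compact`), so that distinct pairs, triples and quadruples go to
affinely independent tuples (`VeroneseGenericity.lean`); the parameters are all linear maps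
`Λ : ℝᴷ →L ℝ^q` (`nonempty_continuousLinearEquiv_clm`); the three bad parameter sets are null
(`DoublePointsGenericity`, `TriplePointsGenericity`, `QuadruplePointsGenericity`), so a good
parameter exists in the ball where `f + Λ ∘ ρ` stays an immersion with nearby normal bundle
(`exists_pos_forall_injective_mfderiv_and_norm_normalProj_sub_lt`, `NormalBundlePerturbation.lean`).

* `exists_genericImmersion_perturbation` — the statement above.

Everything here is proved; no definitions, no named facts.

## References

* M. W. Hirsch, *Differential Topology*, GTM 33 (1976), Ch. 3 §2, Thm. 2.7, Exercises 1–2.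
  [HirschDT1976]
* M. Golubitsky, V. Guillemin, *Stable Mappings and Their Singularities*, GTM 14 (1973),
  Ch. III §3, Prop. 3.2, Cor. 3.3.
* R. C. Kirby, *The Topology of 4-Manifolds*, LNM 1374 (1989), Ch. VI (generic immersions
  `M⁴ ↬ ℝ⁶`). [Kirby1989]
-/

open scoped Manifold ContDiff Topology
open Set Function Module MeasureTheory Metric

noncomputable section

universe u

namespace Literature.Topology.Immersions

/-- Local notation: `𝔼 n` is the model Euclidean space `EuclideanSpace ℝ (Fin n)`. -/
local notation "𝔼 " n:arg => EuclideanSpace ℝ (Fin n)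

open Literature.Geometry.Manifold (dense_compl_of_volume_eq_zero)

variable {n q : ℕ} {M : Type u} [TopologicalSpace M] [ChartedSpace (𝔼 n) M]
  [T2Space M] [SecondCountableTopology M] [CompactSpace M] [IsManifold (𝓡 n) ∞ M]

/-- Transport of a pair through a linear map. [folklore] -/
theorem comp_vecCons_pair {V W : Type*} (L : V → W) (a c : V) : L ∘ ![a, c] = ![L a, L c] := by
  funext i
  fin_cases i <;> rfl

/-- Transport of a triple through a linear map. [folklore] -/
theorem comp_vecCons_triple {V W : Type*} (L : V → W) (a c e : V) :
    L ∘ ![a, c, e] = ![L a, L c, L e] := by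
  funext i
  fin_cases i <;> rfl

/-- **A generic immersion next to any immersion** (`4 dim M < 3q`; Hirsch Ch. 3 §2 Ex. 1–2).
For a `C^∞` immersion `f : M → ℝ^q` of a compact manifold and `ε > 0` there are a `C^∞`
injective `ρ : M → ℝᴷ` and a linear `Λ : ℝᴷ →L ℝ^q` with `‖Λ‖ < ε` such that, writing
`g = f + Λ ∘ ρ`:
* `f + tΛ ∘ ρ` is an immersion for all `|t| ≤ 1` (a regular homotopy from `f` to `g`) whose
  normal projections stay within distance `< 1` of those of `f` (so that all the normal bundles
  along the homotopy are isomorphic to that of `f`, `ProjBundle.isIso_proj_of_norm_sub_lt_one`);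
* every double point of `g` is transverse: `x ≠ y`, `g x = g y` `⇒`
  `(ξ, η) ↦ dg_x ξ - dg_y η` is onto `ℝ^q`;
* every triple point of `g` is transverse: `(ξ, η, θ) ↦ (dg_x ξ - dg_y η, dg_y η - dg_z θ)` is
  onto `ℝ^q × ℝ^q` at pairwise distinct `x, y, z` with `g x = g y = g z`;
* `g` has no quadruple point.
[cite: HirschDT1976, Ch. 3 §2, Thm. 2.7 and Ex. 1–2] -/
theorem exists_genericImmersion_perturbation (hdim : n + (n + (n + n)) < q + (q + q))
    {f : M → 𝔼 q} (hf : ContMDiff (𝓡 n) (𝓡 q) ∞ f)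
    (himm : ∀ x, Injective (mfderiv (𝓡 n) (𝓡 q) f x)) {ε : ℝ} (hε : 0 < ε) :
    ∃ (K : ℕ) (ρ : M → 𝔼 K) (Λ : 𝔼 K →L[ℝ] 𝔼 q),
      ContMDiff (𝓡 n) (𝓡 K) ∞ ρ ∧ Injective ρ ∧ ‖Λ‖ < ε ∧
      (∀ t : ℝ, |t| ≤ 1 →
        ∀ x, Injective (mfderiv (𝓡 n) (𝓡 q) (fun z => f z + (t • Λ) (ρ z)) x) ∧
          ‖ProjBundle.normalProj n f x - ProjBundle.normalProj n (fun z => f z + (t • Λ) (ρ z)) x‖ < 1) ∧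
      (∀ x y : M, x ≠ y → f x + Λ (ρ x) = f y + Λ (ρ y) →
        ∀ w : 𝔼 q, ∃ ζ : 𝔼 n × 𝔼 n,
          ediff n q (fun z => f z + Λ (ρ z)) x ζ.1 - ediff n q (fun z => f z + Λ (ρ z)) y ζ.2 = w) ∧
      (∀ x y z : M, x ≠ y → y ≠ z → x ≠ z →
        f x + Λ (ρ x) = f y + Λ (ρ y) → f y + Λ (ρ y) = f z + Λ (ρ z) →
        ∀ w : 𝔼 q × 𝔼 q, ∃ ζ : 𝔼 n × 𝔼 n × 𝔼 n,
          (ediff n q (fun t => f t + Λ (ρ t)) x ζ.1 - ediff n q (fun t => f t + Λ (ρ t)) y ζ.2.1,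
            ediff n q (fun t => f t + Λ (ρ t)) y ζ.2.1 -
              ediff n q (fun t => f t + Λ (ρ t)) z ζ.2.2) = w) ∧
      (∀ a b c d : M, a ≠ b → a ≠ c → a ≠ d → b ≠ c → b ≠ d → c ≠ d →
        f a + Λ (ρ a) = f b + Λ (ρ b) → f b + Λ (ρ b) = f c + Λ (ρ c) →
        f c + Λ (ρ c) ≠ f d + Λ (ρ d)) := by
  -- a Whitney embedding `ρ₀ : M → ℝ^{k₀}` and the Veronese-upgraded `ρ`
  obtain ⟨k₀, ρ₀, hρ₀s, hρ₀e, -⟩ := exists_embedding_euclidean_of_compact (I := 𝓡 n) (M := M)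
  have hρ₀i : Injective ρ₀ := hρ₀e.injective
  let K : ℕ := Fintype.card (VIdx k₀)
  let Lv : EuclideanSpace ℝ (VIdx k₀) ≃L[ℝ] 𝔼 K :=
    (LinearIsometryEquiv.piLpCongrLeft 2 ℝ ℝ (Fintype.equivFin (VIdx k₀))).toContinuousLinearEquiv
  let ρ : M → 𝔼 K := fun x => Lv (veronese k₀ (ρ₀ x))
  have hρs : ContMDiff (𝓡 n) (𝓡 K) ∞ ρ :=
    (Lv.contDiff.comp contDiff_veronese).comp_contMDiff hρ₀s
  have hρi : Injective ρ := fun x y h => hρ₀i (injective_veronese (Lv.injective h))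
  let Lvl : EuclideanSpace ℝ (VIdx k₀) →ₗ[ℝ] 𝔼 K :=
    (Lv : EuclideanSpace ℝ (VIdx k₀) →L[ℝ] 𝔼 K).toLinearMap
  have hLvl : ∀ v, Lvl v = Lv v := fun _ => rfl
  have hLvker : LinearMap.ker Lvl = ⊥ := LinearMap.ker_eq_bot.2 (by exact Lv.injective)
  have hρ3 : ∀ x y z : M, x ≠ y → y ≠ z → x ≠ z →
      LinearIndependent ℝ ![ρ x - ρ y, ρ y - ρ z] := by
    intro x y z hxy hyz hxz
    have h := (linearIndependent_veronese_pair_sub (k := k₀) (hρ₀i.ne hxy) (hρ₀i.ne hyz)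
      (hρ₀i.ne hxz)).map' Lvl hLvker
    rw [comp_vecCons_pair, map_sub, map_sub] at h
    exact h
  have hρ4 : ∀ a b c d : M, a ≠ b → a ≠ c → a ≠ d → b ≠ c → b ≠ d → c ≠ d →
      LinearIndependent ℝ ![ρ a - ρ b, ρ b - ρ c, ρ c - ρ d] := by
    intro a b c d hab hac had hbc hbd hcd
    have h := (linearIndependent_veronese_triple_sub (k := k₀) (hρ₀i.ne hab) (hρ₀i.ne hac)
      (hρ₀i.ne had) (hρ₀i.ne hbc) (hρ₀i.ne hbd) (hρ₀i.ne hcd)).map' Lvl hLvker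
    rw [comp_vecCons_triple, map_sub, map_sub, map_sub] at h
    exact h
  -- the parameters: all linear maps `ℝᴷ →L ℝ^q`
  obtain ⟨Te⟩ := nonempty_continuousLinearEquiv_clm (k := K) (q := q)
  let T : 𝔼 (K * q) →L[ℝ] (𝔼 K →L[ℝ] 𝔼 q) := Te
  have hTs : Surjective T := Te.surjective
  have hT1 : ∀ u : 𝔼 K, u ≠ 0 → Surjective fun s : 𝔼 (K * q) => T s u := fun u hu =>
    surjective_apply_of_surjective hTs hu
  have hT2 : ∀ u v : 𝔼 K, LinearIndependent ℝ ![u, v] →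
      Surjective fun s : 𝔼 (K * q) => (T s u, T s v) := fun u v huv =>
    surjective_apply_pair_of_surjective hTs huv
  have hT3 : ∀ u v w : 𝔼 K, LinearIndependent ℝ ![u, v, w] →
      Surjective fun s : 𝔼 (K * q) => (T s u, T s v, T s w) := fun u v w h =>
    surjective_apply_triple_of_surjective hTs h
  -- the three null sets of bad parameters, and the dense good set
  have hN₂ := volume_setOf_not_transverse_doublePoints_eq_zero hf hρs hρi hT1
  have hN₃ := volume_setOf_not_transverse_triplePoints_eq_zero hf hρs hρ3 hT2
  have hN₄ := volume_setOf_exists_quadruplePoint_eq_zero hdim hf hρs hρ4 hT3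
  have hD := dense_compl_of_volume_eq_zero
    (measure_union_null (measure_union_null hN₂ hN₃) hN₄)
  -- the stability radius and a good small parameter
  obtain ⟨ε₁, hε₁, hstab⟩ :=
    exists_pos_forall_injective_mfderiv_and_norm_normalProj_sub_lt hf himm hρs
  have hO : IsOpen {s : 𝔼 (K * q) | ‖T s‖ < min ε ε₁} :=
    isOpen_lt (continuous_norm.comp T.continuous) continuous_const
  have hO0 : (0 : 𝔼 (K * q)) ∈ {s : 𝔼 (K * q) | ‖T s‖ < min ε ε₁} := by
    show ‖T 0‖ < min ε ε₁
    rw [map_zero, norm_zero]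
    exact lt_min hε hε₁
  obtain ⟨s, hsO, hsD⟩ := hD.inter_open_nonempty _ hO ⟨0, hO0⟩
  have hsε : ‖T s‖ < ε := lt_of_lt_of_le hsO (min_le_left _ _)
  have hsε₁ : ‖T s‖ < ε₁ := lt_of_lt_of_le hsO (min_le_right _ _)
  -- unpack the good parameter
  simp only [mem_compl_iff, mem_union, not_or] at hsD
  obtain ⟨⟨hs₂, hs₃⟩, hs₄⟩ := hsD
  refine ⟨K, ρ, T s, hρs, hρi, hsε, fun t ht x => ?_, fun x y hxy hdouble => ?_,
    fun x y z hxy hyz hxz hd1 hd2 => ?_, fun a b c d hab hac had hbc hbd hcd hd1 hd2 hd3 => ?_⟩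
  · -- immersions with nearby normal bundles along the regular homotopy
    refine hstab (t • T s) ?_ x
    calc ‖t • T s‖ = |t| * ‖T s‖ := by rw [norm_smul, Real.norm_eq_abs]
      _ ≤ 1 * ‖T s‖ := by gcongr
      _ < ε₁ := by rw [one_mul]; exact hsε₁
  · by_contra hbad
    exact hs₂ ⟨x, y, hxy, hdouble, hbad⟩
  · by_contra hbad
    exact hs₃ ⟨x, y, z, hxy, hyz, hxz, hd1, hd2, hbad⟩
  · exact hs₄ ⟨a, b, c, d, hab, hac, had, hbc, hbd, hcd, hd1, hd2, hd3⟩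

end Literature.Topology.Immersions
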